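import Mathlib
import HarnessLib
import HarnessLib.Audit
import Summits.RiemannHypothesis.Statement
import Literature.NumberTheory.LFunctions.WeilExplicit
import Literature.NumberTheory.LFunctions.RiemannXi
import Summits.RiemannHypothesis.RiemannHypothesis.Theorems.WeilWindowFlowPrimeTwoWindow
import Summits.RiemannHypothesis.RiemannHypothesis.Theorems.WeilCombAssembly
import Summits.RiemannHypothesis.RiemannHypothesis.Theorems.SignConeConeMagnification
import Summits.RiemannHypothesis.RiemannHypothesis.Theorems.MotivicDoorRungs
import HarnessLib.Audit.Status.Attr

/-!
Route: WeilPos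

DORMANT since 2026-08-29T21:04:20Z (census g0: costume (trib-confirmed census-trib-costume-B 2026-08-29; 21-frontier 19:16:23Z (b)); reversible --off) — unstaffed, not closed; items shared with open routes are served there. `ledger route dormant <id> --off` reactivates.

# Route WeilPos — Weil positivity, prime by prime, with unit slack (semi-local ladder × 2001
magnification)

**Thesis X♭ (words).** It suffices to show UNIT-SLACK Weil positivity at every cutoff: for every a >
0 and every
smooth g : ℝ → ℂ supported in [-a, a], Re W(g ⋆ g̃) ≥ −‖g‖₂² — Bombieri's ground energy satisfies
ε(a) ≥ −1 for all a
(additive normalisation of `Literature/NumberTheory/LFunctions/WeilExplicit`, symmetric at 1/2).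
Rung by rung this is
strictly weaker than exact positivity ε(a) ≥ 0 (item `WeilposThesis`, the shared exact face, ≡ RH by
Weil's criterion
`Literature.NumberTheory.LFunctions.riemannHypothesis_iff_forall_weilPositivityOn`), and it still
decides RH: by the
2001 MAGNIFICATION theorem W-MAG, kernel-checked in the tree as
`Summit.RiemannHypothesis.RiemannHypothesis.Theorems.ConeMagnification_proof` (crux
ConeMagnification of the
superseded route SignCone, closed 2026-08-17), nonnegative unit-slack weights at every cutoff force
RH, and the von
Mangoldt weight Λ is such a weight as soon as X♭ holds.

Lean: `∀ a : ℝ, 0 < a → ∀ g : ℝ → ℂ, Literature.NumberTheory.LFunctions.IsWeilTest g → tsupport g ⊆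
Set.Icc (-a) a → -(∫ t, ‖g t‖ ^ 2) ≤ (Literature.NumberTheory.LFunctions.weilQuadratic g).re`  (item
`WeilposSlackThesis`, target, rank 0; in `closes` it is the head of the residual conjunct)

Constants verified with `lean search --decl` / `lean check`:
`Literature.NumberTheory.LFunctions.IsWeilTest`,
`Literature.NumberTheory.LFunctions.weilQuadratic`,
`Literature.NumberTheory.LFunctions.WeilPositivityOn`,
`Summit.RiemannHypothesis.RiemannHypothesis.Theorems.ConeMagnification_proof`,
`Summit.RiemannHypothesis`.

## Assembly

Deciding theorem (D-0027 §2.1, re-cut 2026-08-17 by the judge-repair unit, rev 10; certified by the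
H21 audit, axioms
propext/Classical.choice/Quot.sound), over the CONJUNCT SPLIT X♭ = Rung ∧ (Rung → X♭):
`theorem closes (hR : WeilposSlackRungLog2) (hRes : SlackResidualLog2) : Summit.RiemannHypothesis :=
have hS : WeilposSlackThesis := hRes hR; ConeMagnification_proof (fun a ha => ⟨Λ, Λ ≥ 0, Λ 1 = 0, hS
at cutoff a⟩)`
— the fake Weil form of ConeMagnification with weight c := Λ IS Weil's functional (`weilPolarTerm −
weilPrimeTerm +
weilArchTerm`, by `unfold; ring`), so the unit-slack hypothesis of W-MAG at cutoff a is literally X♭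
at cutoff a. The
route thus decides RH THROUGH the certified 2001 proof (slack-cone compactness → fake PNT →
Chebyshev → continuation →
Carathéodory → comb/type inequalities → design data → deficit spine → Landau transfer), not through
Weil's criterion.
Binders: the ATTACKED conjunct `WeilposSlackRungLog2` (the first slack rung past the certified exact
ones: cutoff
log 2, primes 2 and 3, O(1) margin, certifiable by the landed Yoshida moment format) and the
DECLARED RESIDUAL
`SlackResidualLog2 := Rung → X♭` (≡ RH given the rung; no mechanism claimed; tenure climbs the
ladder by superseding
it with Rung_{k+1} ∧ Residual_{k+1}, never by attacking it). residual: SlackResidualLog2. The exact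
face
`WeilposThesis` (X ⇒ X♭ trivially; shared with WeilAdversary), the old `Assembly : X → RH` (Weil's
criterion,
closed) and the certified exact rungs WeilposRungPrime2 ((log 3)/2) / PrimeTwoWindow stay as banked
calibration;
the judge-named unconditional test of the sign-cone uncertainty lever on the single-high-window
oscillatory class
(`OscSingleWindow`, re-homed from SignCone) is a SUPPORT with its consequence edge
`OscSingleWindowOfSlackThesis`
(a consequence of X♭ cannot be load-bearing for `closes`; a refutation of it kills X♭ and RH).

Rationale: WHY THIS LINE. `WeilPositivityOn a` and its slack form involve only the prime powers n < e^{2a} (the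
prime term of W(g ⋆ g̃) for supp g ⊆ [-a, a]), so the thesis is Connes' semi-local ladder S = {∞} ∪
{p ≤ e^{2a}} [Connes1999 §VII; arXiv:2106.01715 §2], now run with UNIT SLACK. Why slack: (i) the
exact ladder has no margin — inf Q_W,λ decays like e^{−cλ²} (6·10⁻⁸ at λ² = 3, 2.4·10⁻⁴⁸ at λ² = 11,
arXiv:2106.01715 §2.5; NewmanConjecture barrier at a = ∞), so certified exact rungs stop almost at
once (tree: (log 3)/2 exact, item WeilposRungPrime2 CLOSED by the Stage-C kernel certificate
`weilPositivityOn_log_three_half`; 59/100 odd sector with margin 4·10⁻⁷, WeilTwoPrimeOddMargin*);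
the slack rung ε(a) ≥ −1 keeps an O(1) margin at EVERY finite cutoff and is certifiable by the
landed, proved-sound Yoshida moment format (WeilCert3/WeilCert23: margin_step3 + Bessel +
core_nonnegK, Bessel coefficient κ shifted by +1). (ii) Slack costs nothing at a = ∞: the 2001
magnification theorem W-MAG (archive rh-w-magnification Thm 1.2), kernel-checked 2026-08-17 as
`Theorems.ConeMagnification_proof` (13 landed stubs: compactness p129201, fake PNT p130740,
Chebyshev p131015, continuation p130893, Laplace positivity p132066, Carathéodory p133591,
SlackDesign = W-MAG Thm 3.1, deficit spine p137772, Landau transfer p130783), says unit-slack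
weights at every cutoff force RH; with c := Λ its hypothesis is X♭ verbatim, which is the new
`closes`. (iii) Each certified slack rung is what W-MAG consumes at that cutoff and, through the
(unformalised) effective magnification W-EFFMAG, excludes off-line zeros (β₀, γ₀) with A(1, β₀, γ₀)
≤ a. The archimedean rung a ≤ (log 2)/2 [Yoshida1992 Thm 1; ConnesConsani2021] and the first-prime
rung (log 3)/2 are PROVED in the tree; PrimeTwoWindow (∃ a > (log 2)/2) is PROVED (Suzuki
continuity). Imported areas: harmonic analysis on the idele class group / NCG (the ladder), LP/conic
duality and the 2001 fake-explicit-formula programme (the magnification; route SignCone, superseded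
by this route 2026-08-17, whose open supports are re-homed here). Function-field dictionary
[Weil1948]: W ↔ trace of Frobenius correspondences, positivity ↔ Castelnuovo–Severi; no operator is
posited (that is route SpectralTrace).

RANKED CRUXES. #3 WeilposSlackRungLog2 (stmt-18182; ATTACKED CONJUNCT, binder hR of closes): −‖g‖₂²
≤ Re W(g ⋆ g̃) for supp g ⊆ [−log 2, log 2] (primes 2, 3; = −‖g‖₂² ≤ E₂₃(g) by
`weilPositivityOn_log_two_iff` / `weilQuadratic_re_eq_weilTwoPrimeQuadratic`), the first slack rung
past the certified exact ones, certifiable by the landed proved-sound WeilCert23 format with the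
Bessel coefficient κ shifted by +1 (why it might fail: RH-implied; no WeilCert23 instance at b = log
2 yet — endpoint enclosure, both parity blocks, a₀ ≥ log 2; slack makes precision trivial, not the
reduction). #8 SlackResidualLog2 (stmt-18218; DECLARED RESIDUAL, binder hRes): Rung → X♭, written
self-contained (why it "might fail": it is ≡ RH given the rung — residual by design, never a proof
target; the ladder climbs by superseding it with Rung_{k+1} ∧ Residual_{k+1} at cutoffs 1, 13/10,
(log 210)/2, …). TARGET #0 WeilposSlackThesis (stmt-18180) = X♭, in-cone as the residual's head.
SUPPORTS (not load-bearing): OscSingleWindow (stmt-18226, rank 6; re-homed SignCone stmt-18012, the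
judge's 'per-gap uncertainty inequality closing a nontrivial oscillatory sub-class': the prime-free
unit-slack sign-cone inequality Re W_ar(F) ≥ −Re F(0) for node-nonnegative F ∈ P(a) whose far-field
negativity sits in ONE window T ≤ |t| ≤ T + log 2, T ≥ 3 — a consequence of X♭ (edge
OscSingleWindowOfSlackThesis, stmt-18227, provable now), class non-empty for a > 3/2 (p150937),
attack = Poisson summation window by window + stationary phase for windowed chirps (tree:
stationaryPhase, vanDerCorput_lemma47) + a completion-cost inequality, skeleton d4a9010c3867, card
Cruxes/SignConeOscillatory/Ideas/lattice-chirp-completion.md; why it might fail: the completion-cost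
margin (1+T)/π − 1 ≈ 0.27 at T = 3 is heuristic); SlackRungLog2OfSlackThesis (stmt-18200, X♭ → Rung,
provable now); WeilposRungArch (provable now: `weilPositivityOn_of_le_log_two_half le_rfl`);
WeilposLiFace (Li face, ≡ RH, dedup anchor); WeilposConverse (RH → X, provable now). BANKED / ASIDE
(calibration): WeilposRungPrime2 (exact (log 3)/2, kernel certificate, closed), PrimeTwoWindow
(closed), Assembly (X → RH, closed), WeilposThesis = exact face X (≡ RH; shared crux of
WeilAdversary; auto-asided here once it left the cone).

KILL CRITERIA. (i) A certified Weil test g at ANY cutoff with Re W(g ⋆ g̃) < −‖g‖₂² refutes X♭ and,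
through `closes`' contrapositive companions (`signConeInequality_iff_riemannHypothesis`,
`weil_criterion_holds`), RH itself — the route closes with the summit's negation. (ii) A certified
node-nonnegative F in the single-window class with Re W_ar(F) < −Re F(0) does the same (kills
OscSingleWindow, X♭, RH). (iii) If the slack certificate at b = log 2 cannot be produced by the
landed format within one compute cycle for reasons of the REDUCTION (not precision), the slack
ladder is not cheaper than the exact one and the re-cut has no teeth: contract to the support
OscSingleWindow and record it. (iv) A no-go showing that semi-local unit-slack positivity for S ∋ 2,
3 needs global input equivalent to RH (Connes–Consani arXiv:1910.14368 §1 made sharp) closes the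
route exhausted (rungs survive as RH-corollaries).

NOT DECOMPOSED YET. X♭ is split ONLY as the conjunct pair Rung ∧ (Rung → X♭) with the residual
DECLARED: by monotonicity in a every cutoff/tail split leaves a tail ≡ RH (SignCone strategist
census, Cruxes/SignConeOscillatory/STRATEGY-CENSUS.md §1–4: no split short of W-EFFMAG), so no
decomposition pretends otherwise; further rungs are filed by superseding the residual. Not filed
yet: slack rungs a = 1 (n ≤ 7), 13/10, (log 210)/2 (need the k-prime analytic form E_{≤x}
generalising WeilTwoPrimeQuadratic); the formalisation of W-EFFMAG (rung ⇒ explicit zero exclusion);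
SignCone's remaining open support SignConeUpTo210 (sign-cone rung, weaker than the Λ-slack rung at
the same cutoff).

CHEAPEST FALSIFIER. One kit job mirroring gen/cert23.py at a₀ = b ≥ log 2 (rational enclosure of log
2), both parity blocks, κ ↦ κ + 1: if `WeilCert23.check` cannot be made true even with the +1 shift,
kill criterion (iii) fires; the same run at κ (no shift) reports how far the EXACT rung at log 2 is
(WindowStep/WeilGroundState interest). For OscSingleWindow: the standing SignCone LP duals
(DUAL-NUMERICS j023039, j020376/j020695; minima +0.02…+0.05 at a ≤ 2.3) restricted to single-window
F — any value < −1 kills it and RH.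

Novelty: NOVELTY — SUMMARY: nearest prior art is Connes' own semi-local programme (Connes1999 §VII;
ConnesConsani2021 = arXiv:2006.13771; Connes–Consani ζ-cycles arXiv:2106.01715 §2; CCM
arXiv:2310.18423, arXiv:2511.22755; Connes 2026 arXiv:2602.04022 §7) on top of Yoshida1992 Thm 1 and
Bombieri2000 Thm 12. DELTA: no new mechanism (expected grade known/variant); the route only (i)
poses the first-prime rung as ONE closed kernel-checkable Prop
Literature.NumberTheory.LFunctions.WeilPositivityOn ((log 3)/2) in a normalisation audited against
Yoshida1992 p.281 / Bombieri2000 Thm 2, and (ii) sits on a tree that now PROVES the archimedean rung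
by a Lean-kernel certificate
(Literature.NumberTheory.LFunctions.weilPositivityOn_log_two_half_holds) and Weil's criterion
(Literature.NumberTheory.LFunctions.weil_criterion_holds) — so a CERTIFIED λ² = 3 rung, which no
paper has (published evidence is floating point only: margin < 6·10⁻⁸ at L = log 3, arXiv:2106.01715
§2.3; "finite-cutoff Weil positivity is not known unconditionally" beyond the Yoshida–Bombieri
range, doi:10.4171/elm/37/3 p.17), would be a new RESULT by a known mechanism.
Searched before claiming (retriage planner 2026-08-14): lit search "Weil positivity" (local +
zbMATH/Crossref), lit search --hybrid "semi-local trace formula positivity", lit frontier / lit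
bridges RiemannHypothesis, barrier catalogue (21 files), page reads of arXiv:2106.01715 pp.3–10,
arXiv:1910.14368 pp.2–3, arXiv:2602.04022 §5–§7, doi:10.4171/elm/37/3 p.17 + ref  [refs: 10.4171/elm/37/3, 2006.13771, 2106.01715, 2310.18423, 2511.22755, 2602.04022, 1910.14368, 2511.23257, doi:10.4171/elm/37/3, book:functions2001-dynamical-spectral-arithmetic-zeta-functions-ams-special, Connes1999, ConnesConsani2021, Yoshida1992, Bombieri2000, Li1997, BombieriLagarias1999]

Barriers (technique_class: Weil-positivity semi-local-trace-formula explicit-formula): BARRIERS — SUMMARY (catalogue Literature/Barriers/RiemannHypothesis, all 21 entries examined;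
technique_class: Weil-positivity semi-local-trace-formula explicit-formula): DeBrangesPositivity
does not bite (X and every rung are RH-implied, unlike de Branges' stronger conditions);
NewmanConjecture APPLIES to the target X (no margin) but not to a fixed rung; DavenportHeilbronn and
DiamondMontgomeryVorhauer2006_thm1 are evaded by construction (Euler product and functional equation
both enter the Weil form); the Hilbert–Pólya entries are not engaged; the load-bearing obstruction
is UNCATALOGUED: Connes–Consani's diagnosis (arXiv:1910.14368 §1) that a purely semi-local cutoff
cannot give positivity without the global Poisson normalisation — not evaded; the bet is that one
rung (λ² = 3) is a finite certified computation à la Yoshida, and kill criterion (ii) of the thesis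
is this barrier made sharp.
- Literature.Barriers.RiemannHypothesis.DeBrangesPositivity [ConreyLi2000]: de Branges' (3.1)/(3.3)
are strictly STRONGER than RH and printed false; X = WeilPositivity and WeilPositivityOn a are
IMPLIED by RH (Literature.NumberTheory.LFunctions.weil_criterion_holds.mp,
Literature.NumberTheory.LFunctions.WeilPositivityOn.mono), so no Conrey–Li-type counterexample
exists unless RH fails. Lesson kept: claim positivity only for the exact Weil form with polar terms
(ConnesConsani2021 Thm 1 carries extra vanishing hypotheses on ĝ and bounds the archimedean term
only; reground note on stmt-0101)

History (route lifecycle, newest last):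
- 2026-08-16T04:16:47Z · AUTO-CRUX (backfill): WeilposThesis — hypotheses of the deciding theorem that nothing in the route derives are cruxes (operator:999:1085951)
- 2026-08-17T14:24:52Z · AUTO-CRUX (edit): WeilposSlackThesis — hypotheses of the deciding theorem that nothing in the route derives are cruxes (planner-rrepair-RiemannHypothesis-WeilPos-judg-84616b26-0)
- 2026-08-17T14:36:19Z · rev 9: restated SlackResidualLog2 (stmt-RiemannHypothesis-18211) — judge-repair step 3b: SlackResidualLog2 restated self-contained in the rung (the renderer could not resolve the aside sibling decl WeilposSlackRungLog2); defini (planner-rrepair-RiemannHypothesis-WeilPos-judg-84616b26-0)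
- 2026-08-17T14:38:49Z · rev 11: dropped OscSingleWindow, OscSingleWindowOfSlackThesis — judge-repair step 3c: drop the auto-asided crux OscSingleWindow (stmt-18181) together with its consequence edge (stmt-18201) in order to re-file the same statem (planner-rrepair-RiemannHypothesis-WeilPos-judg-84616b26-0)
- 2026-08-29T21:04:20Z · DORMANT — census g0: costume (trib-confirmed census-trib-costume-B 2026-08-29; 21-frontier 19:16:23Z (b)); reversible --off (operator:999:1847254)

sub-problem: RiemannHypothesis · status: dormant · opened planner-RiemannHypothesis-Survey-0 2026-08-13T06:05:37Z · rev 14 · ledger route-RiemannHypothesis-WeilPos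
GENERATED by the gate from the ledger (D-0016/17). Provers cite these decls: `theorem foo : Summit.RiemannHypothesis.RiemannHypothesis.Theses.WeilPos.<Decl> := …` in Summits/RiemannHypothesis/RiemannHypothesis/Theorems/<Name>.lean.
-/

namespace Summit.RiemannHypothesis.RiemannHypothesis.Theses.WeilPos

open scoped BigOperators Topology Manifold Classical MeasureTheory ProbabilityTheory Matrix InnerProductSpace ComplexConjugate ContinuousMap
open Filter Set Function TopologicalSpace MeasureTheory

attribute [summit_statement] _root_.Summit.RiemannHypothesis

open Summit

/-- item stmt-RiemannHypothesis-18180 · crux (kind.auto-crux: conjecture-grade) · rank 0 · open · by planner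
why it might fail: ≡ RH in-tree (RH ⇒ WeilPositivity ⇒ X♭; X♭ ⇒ RH = closes via W-MAG): false iff an off-line zero exists (W-EFFMAG: it empties the unit-slack cone beyond an explicit cutoff). No rung-wise argument reaches a = ∞; the slack buys O(1) margins only at finite cutoffs.
sources: Bombieri2000 (Thm 1–2; §4 ground energy ε(a)), Weil1952, archive:2001/summits/rh-w-magnification/free/y1 (W-MAG Thm 1.2), archive:2001/summits/rh-w-effmag/free/y2 (effective magnification), lean: Summit.RiemannHypothesis.RiemannHypothesis.Theorems.ConeMagnification_proof, Literature.NumberTheory.LFunctions.weil_criterion_holds, Literature.NumberTheory.LFunctions.WeilPositivity.of_riemannHypothesis, Literature.Barriers.RiemannHypothesis.NewmanConjecture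
[target] X♭ (UNIT-SLACK Weil positivity at every cutoff): for every a > 0 and every Weil test g
supported in [-a, a], Re W(g ⋆ g̃) ≥ −‖g‖₂², i.e. Bombieri's ground energy ε(a) ≥ −1 for all a
(instead of ε(a) ≥ 0 = item WeilposThesis). Rung by rung strictly weaker than exact positivity (O(1)
margin: certifiable far beyond λ² = 3), yet it decides RH through the kernel-checked 2001
MAGNIFICATION theorem W-MAG (Theorems.ConeMagnification_proof, crux ConeMagnification of the
superseded route SignCone, closed 2026-08-17): the von Mangoldt weight Λ is one admissible
unit-slack weight at every cutoff. The deciding theorem `closes : WeilposSlackThesis → RH` is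
exactly that instantiation (c_a := Λ; the fake Weil form with c = Λ is weilFunctional by `ring`). RH
⇒ X♭ via WeilPositivity.of_riemannHypothesis. [difficulty: open-problem] -/
@[route_item "route-RiemannHypothesis-WeilPos"]
def WeilposSlackThesis : Prop :=
  ∀ a : ℝ, 0 < a → ∀ g : ℝ → ℂ, Literature.NumberTheory.LFunctions.IsWeilTest g → tsupport g ⊆ Set.Icc (-a) a → -(∫ t, ‖g t‖ ^ 2) ≤ (Literature.NumberTheory.LFunctions.weilQuadratic g).re

/-- item stmt-RiemannHypothesis-18182 · crux · rank 3 · closed · proved by Summit.RiemannHypothesis.RiemannHypothesis.Theorems.WeilposSlackRungLog2_proof @ 2b32ea391ff3 (prover) · by planner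
why it might fail: RH-implied (false only with RH). As a target: no certificate instance at b = log 2 exists — WeilCert23 is proved sound but instantiated only at b = 59/100, odd block (margin 4·10⁻⁷); log 2 needs an endpoint enclosure, both parity blocks, larger a₀/N. Slack makes precision trivial, not the reduction.
sources: Yoshida1992 (§6, Thm 1 p.310: moment-certificate method), arXiv:2106.01715 (§2.3: semi-local form for S = {∞,2,3}, prime-by-prime numerics), Bombieri2000 (§4 ε(a); Thm 12), lean: Literature.NumberTheory.LFunctions.weilPositivityOn_log_two_iff, Literature.NumberTheory.LFunctions.WeilCert23.weilTwoPrimeQuadratic_nonneg_of_check, Literature.NumberTheory.LFunctions.WeilCert23.weilTwoPrimeQuadratic_margin_of_parts, archive:2001/summits/rh-w-magnification/free/y1 (what a slack rung feeds)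
[crux] FIRST OPEN RUNG OF THE SLACK LADDER (two primes): for Weil tests g supported in [−log 2, log
2] (supp(g ⋆ g̃) ⊆ [−log 4, log 4]: exactly the prime powers 2 and 3 enter W), Re W(g ⋆ g̃) ≥
−‖g‖₂², i.e. ε(log 2) ≥ −1 — the cutoff-log 2 instance of X♭ consumed by W-MAG, Connes' semi-local
positivity for S = {∞, 2, 3} with unit slack. Strictly weaker than the exact rung WeilPositivityOn
(log 2) (= WindowStep/WeilGroundState targets; exact margins decay like e^{−cλ²}, 6·10⁻⁸ already at
λ² = 3) and certifiable with O(1) room: by weilPositivityOn_log_two_iff /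
weilQuadratic_re_eq_weilTwoPrimeQuadratic it is −‖g‖₂² ≤ E₂₃(g) on C(log 2), and the landed,
proved-sound Yoshida moment format WeilCert23 (margin_step3 + Bessel + core_nonnegK) certifies it
with the Bessel coefficient κ shifted by +1 — remaining work: rational b ≥ log 2 enclosure, both
parity blocks, data regenerated at a₀ ≥ log 2 (one kit job mirroring gen/cert23.py). Implied by RH
and by the exact rung; implies SignCone's sign-cone rung at cutoff log 2 (Λ ∈ K♭). Next rungs (not
filed): a = 1 (n ≤ 7), 13/10, (log 210)/2 need the k-prime analytic form E_{≤x}. [difficulty: M] -/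
@[route_item "route-RiemannHypothesis-WeilPos", crux]
def WeilposSlackRungLog2 : Prop :=
  ∀ g : ℝ → ℂ, Literature.NumberTheory.LFunctions.IsWeilTest g → tsupport g ⊆ Set.Icc (-Real.log 2) (Real.log 2) → -(∫ t, ‖g t‖ ^ 2) ≤ (Literature.NumberTheory.LFunctions.weilQuadratic g).re

-- `WeilposSlackRungLog2` holds: proved by `Summit.RiemannHypothesis.RiemannHypothesis.Theorems.WeilposSlackRungLog2_proof` @ 2b32ea391ff3 (its module imports this route file, so no `_holds` link can be stated here).

-- earlier SlackResidualLog2 (stmt-RiemannHypothesis-18211, replaced 2026-08-17T14:36:19Z -> stmt-RiemannHypothesis-18218): retired by None — WeilposSlackRungLog2 → WeilposSlackThesis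
/-- item stmt-RiemannHypothesis-18218 · crux · rank 8 · open · by planner
why it might fail: ≡ RH once the rung is certified (X♭ ↔ RH in-tree): false iff an off-line zero exists; no finite ladder of re-splits exhausts it (NewmanConjecture: no margin at a = ∞; finite cutoffs are blind, j021410). Residual by design — not a proof target.
sources: Bombieri2000 (Thm 1–2), archive:2001/summits/rh-w-effmag/free/y2 (effective magnification tower: why no fixed cutoff suffices), arXiv:2106.01715 (§2.5), Literature.Barriers.RiemannHypothesis.NewmanConjecture, Cruxes/SignConeOscillatory/STRATEGY-CENSUS.md (SignCone strategist: no split short of W-EFFMAG)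
[crux] RESIDUAL CONJUNCT (declared residual) of the conjunct split X♭ = Rung ∧ (Rung → X♭): once the
two-prime slack rung WeilposSlackRungLog2 is in, unit-slack Weil positivity holds at every cutoff.
HONEST STATUS: ≡ RH given the rung (X♭ ↔ RH in-tree by `closes` and
WeilPositivity.of_riemannHypothesis); no mechanism is claimed, and it is NOT a
magnification-from-cutoff-log 2 claim (finite cutoffs are blind to high off-line zeros: SignCone
planted-zero calibration j021410; W-EFFMAG detects (β₀, γ₀) only beyond the tower A(1, β₀, γ₀)). It
exists so that the ladder is typed as what it is — thesis = rung ∧ rest, with the rung a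
load-bearing leaf of `closes` — and tenure CLIMBS by superseding this item at the next rung
(Residual_k ⟸ Rung_{k+1} ∧ Residual_{k+1}: cutoffs 1 (n ≤ 7), 13/10, (log 210)/2, …; each Rung_k a
certified theorem, each Residual_k the new residual), never by attacking it directly. [difficulty:
open-problem] -/
@[route_item "route-RiemannHypothesis-WeilPos", crux]
def SlackResidualLog2 : Prop :=
  (∀ g : ℝ → ℂ, Literature.NumberTheory.LFunctions.IsWeilTest g → tsupport g ⊆ Set.Icc (-Real.log 2) (Real.log 2) → -(∫ t, ‖g t‖ ^ 2) ≤ (Literature.NumberTheory.LFunctions.weilQuadratic g).re) → WeilposSlackThesis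

/-- item stmt-RiemannHypothesis-0098 · aside (kind.auto-crux: conjecture-grade) · rank 0 · open · by planner
why it might fail: X ↔ RH (riemannHypothesis_iff_forall_weilPositivityOn, proved): false iff an off-line zero exists. No margin: inf QW_λ → 0 like e^{-cλ²} (arXiv:2106.01715 §2.5; 2602.04022 §6.4) and Λ ≥ 0 (NewmanConjecture barrier), so no rung-wise or approximate positivity reaches X.
sources: Bombieri2000 (Thm 2 p.193; §4), Weil1952, Yoshida1992 (p.281; §§3-4), arXiv:2106.01715 (§2.5 small eigenvalues), arXiv:2602.04022 (§6.4 p.22), arXiv:1910.14368 (§1, §4: Li's semi-local attempt)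
Thesis X of route WeilPos: Weil's quadratic functional weilQuadratic g = W(g ⋆ g̃) has non-negative
real part for every smooth compactly supported g : ℝ → ℂ (additive normalisation of Literature
WeilExplicit). Equivalent to RH by Weil's criterion [Weil1952; Bombieri2000 Thm 1; Yoshida1992].
Equals ∀ a > 0, WeilPositivityOn a (uniformWeilPositivity_iff_weilPositivity, proved in Literature). -/
@[route_item "route-RiemannHypothesis-WeilPos"]
def WeilposThesis : Prop :=
  ∀ a : ℝ, 0 < a → Literature.NumberTheory.LFunctions.WeilPositivityOn a

/-- item stmt-RiemannHypothesis-0100 · banked · rank 2 · closed · proved by Summit.RiemannHypothesis.RiemannHypothesis.Theorems.WeilposRungPrime2_proof @ 93741d75e904 (prover) · by planner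
why it might fail: False iff RH fails. As proof target: nothing printed once log 2 ∈ supp(g⋆g̃) (Yoshida1992 Thm1: a=(log 2)/2; Bombieri2000 Thm12: |I| small); at L=log 3 the float margin is <6e-8, sign flips at p=2±5e-4 (arXiv:2106.01715 §2.3); finite sections bound inf QW_λ from ABOVE (Cor 2.4) — no certificate yet.
sources: arXiv:2106.01715 (Connes–Consani ζ-cycles §2.3 p.9, Cor 2.4, §2.5), Yoshida1992 (Thm 1 p.310; Prop 7 p.321; problem (I) p.282), Bombieri2000 (Thm 12 p.38), Connes1999 (§VII semi-local trace formula), doi:10.4171/elm/37/3 (Andrews 2026 p.17: finite-cutoff positivity open beyond Yoshida range), arXiv:1910.14368 (§1: semi-local cutoff needs global Poisson normalisation)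
First arithmetic rung of the semi-local ladder: for g smooth with tsupport g ⊆ [-(log 3)/2, (log
3)/2], supp(g⋆g̃) ⊆ [-log 3, log 3] so the prime term of W(g⋆g̃) contains exactly the prime power 2
(terms ± log 2). OPEN; implied by RH (RH → WeilPositivity → this). Connes' semi-local trace formula
for S = {∞, 2} [Connes1999 §VII]; the archimedean rung a ≤ (log 2)/2 is a theorem
[ConnesConsani2021]. Attack: operator-theoretic (compression of scaling action, prolate functions),
variational [Bombieri2000 §§3-5], or certified finite-rank numerics for a lower bound of the ground
energy ε((log 3)/2) ≥ 0. -/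
@[route_item "route-RiemannHypothesis-WeilPos"]
def WeilposRungPrime2 : Prop :=
  Literature.NumberTheory.LFunctions.WeilPositivityOn (Real.log 3 / 2)

-- `WeilposRungPrime2` holds: proved by `Summit.RiemannHypothesis.RiemannHypothesis.Theorems.WeilposRungPrime2_proof` @ 93741d75e904 (its module imports this route file, so no `_holds` link can be stated here).

/-- item stmt-RiemannHypothesis-0101 · support · rank 3 · closed · proved by Summit.RiemannHypothesis.RiemannHypothesis.Theorems.MotivicDoor.Rungs.rung_R1 @ 63e3dbb63739 (planner) · by planner
sources: Yoshida1992 (Thm 1, §6 p.310), lean: Literature.NumberTheory.LFunctions.weilPositivityOn_of_le_log_two_half, Literature.NumberTheory.LFunctions.weilPositivityOn_log_two_half_holds (kernel certificate), arXiv:2006.13771 (ConnesConsani2021 Thm 1, cf. — stronger statement on a subspace)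
Archimedean rung: for tsupport g ⊆ [-(log 2)/2, (log 2)/2] the prime term of W(g⋆g̃) vanishes (no n
≥ 2 with log n < log 2 in the open support), so positivity is a statement about ĝ(0)+ĝ(1) and the
digamma term only. THEOREM in print: Yoshida1992 (support up to a smaller a), ConnesConsani2021 Thm
1 (support [2^{-1/2}, 2^{1/2}] multiplicatively = [-(log 2)/2, (log 2)/2] additively), via prolate
spheroidal wave functions / Sonin. Grounder: if vendored as a Literature fact, this crux becomes the
formal proof target exercising the WeilExplicit API (weilArchTerm, weilMellin) — keep as statement. -/
@[route_item "route-RiemannHypothesis-WeilPos"]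
def WeilposRungArch : Prop :=
  Literature.NumberTheory.LFunctions.WeilPositivityOn (Real.log 2 / 2)

/-- `WeilposRungArch` holds: proved by `Summit.RiemannHypothesis.RiemannHypothesis.Theorems.MotivicDoor.Rungs.rung_R1` @ 63e3dbb63739. -/
theorem WeilposRungArch_holds : WeilposRungArch := _root_.Summit.RiemannHypothesis.RiemannHypothesis.Theorems.MotivicDoor.Rungs.rung_R1

/-- item stmt-RiemannHypothesis-1040 · banked · rank 3 · closed · proved by Summit.RiemannHypothesis.RiemannHypothesis.Theorems.primeTwoWindow_proof @ 434b184f693f (prover) · by planner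
why it might fail: RH-implied (false only if RH fails). As proof target: Yoshida Thm 1 is strict but gives no uniform L²-gap at a=(log 2)/2 and ε(a)→0⁺ is possible; absent an edge-coercivity bound the term −√2·log2·Re(g⋆g̃)(log 2) cannot be absorbed — no printed technique once a prime enters (elm/37/3 p.17).
sources: Yoshida1992 (Thm 1 p.310; problem (I) p.282; Prop 7 p.321), Bombieri2000 (Thm 12 p.38; §§4-5 ground energy ε(a)), doi:10.4171/elm/37/3 (p.17 'finite-cutoff Weil positivity is not known unconditionally'; p.20), arXiv:2602.04022 (§4.1 p.17; §6.4 p.22), arXiv:2106.01715 (§2.3 prime-by-prime numerics), lean: Literature.NumberTheory.LFunctions.weilPositivityOn_of_le_log_two_half, Literature.NumberTheory.LFunctions.WeilPositivityOn.mono, Literature.NumberTheory.LFunctions.weilArchQuadratic_nonneg, Literature.NumberTheory.LFunctions.Bombieri2000Thm12_holds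
[crux] The first Groenwall step past the proved archimedean rung: Weil positivity holds on SOME
window [-a, a] with 2a > log 2, i.e. with the prime 2 genuinely present in W(g*g~). Soft route:
StrictArchimedeanBottom (0 < eps((log 2)/2)) + right-continuity of eps at the dyadic point
(WindowContinuity) give eps > 0 slightly beyond, hence WeilPositivityOn a
(weilGroundEnergy_nonneg_iff_holds). Hard route: a kernel certificate including the p = 2 term (as
WeilPositivityCertificate*.lean). Numerics: p = 2 lowers but does not kill the bottom for e^L in (2,
2.27) (arXiv:2106.01715 §2.3, Fig. testeven2). Nothing unconditional is known in print beyond the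
Yoshida–Bombieri range (doi:10.4171/elm/37/3 p.17); strictly weaker than WeilPos's crux
WeilPositivityOn ((log 3)/2) and implied by RH. -/
@[route_item "route-RiemannHypothesis-WeilPos"]
def PrimeTwoWindow : Prop :=
  ∃ a : ℝ, Real.log 2 / 2 < a ∧ Literature.NumberTheory.LFunctions.WeilPositivityOn a

/-- `PrimeTwoWindow` holds: proved by `Summit.RiemannHypothesis.RiemannHypothesis.Theorems.primeTwoWindow_proof` @ 434b184f693f. -/
theorem PrimeTwoWindow_holds : PrimeTwoWindow := _root_.Summit.RiemannHypothesis.RiemannHypothesis.Theorems.primeTwoWindow_proof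

/-- item stmt-RiemannHypothesis-0102 · support · rank 4 · open · by planner
why it might fail: ↔ RH (Li1997 Thm 1 = Literature.NumberTheory.LFunctions.li_criterion): false iff RH fails; λ_n ≥ 0 known only numerically (n ≲ 1e5) or for small n from verified zero heights; restates the target in Li normalisation.
sources: Li1997 (doi:10.1006/jnth.1997.2137, Thm 1 p.325), BombieriLagarias1999 (Thm 1–2), lean: Literature.NumberTheory.LFunctions.li_criterion, Literature.NumberTheory.LFunctions.keiperLiCoeff
Li's criterion face of X: λ_n = keiperLiCoeff n ≥ 0 for all n ≥ 1. RH ↔ this [Li1997 Thm 1;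
BombieriLagarias1999 Thm 1]; Bombieri–Lagarias Thm 2 identify λ_n with the Weil functional at
explicit test functions, so this is WeilPositivity restricted to a countable family which still
suffices. Filed as dedup anchor for provers working in the Li normalisation; the assembly to RH
needs the fact li_criterion (cite request filed). -/
@[route_item "route-RiemannHypothesis-WeilPos"]
def WeilposLiFace : Prop :=
  ∀ n : ℕ, 1 ≤ n → 0 ≤ Literature.NumberTheory.LFunctions.keiperLiCoeff n

/-- item stmt-RiemannHypothesis-0103 · support · rank 5 · closed · proved by Summit.RiemannHypothesis.RiemannHypothesis.Theorems.MotivicDoor.Rungs.rung_of_riemannHypothesis @ 63e3dbb63739 (planner) · by planner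
sources: Bombieri2000 (Thm 1 easy half, §3 (3.2)), Yoshida1992 (proof of Prop 1, p.286), lean: Literature.NumberTheory.LFunctions.riemannHypothesis_iff_forall_weilPositivityOn (.mp), Literature.NumberTheory.LFunctions.WeilPositivity.of_riemannHypothesis, Literature.NumberTheory.LFunctions.explicit_formula_holds
Easy direction of Weil's criterion: under RH every zero is 1/2+iγ with γ real, and (g⋆g̃)^(1/2+iγ) =
|ĝ(1/2+iγ)|² ≥ 0, so the zero side of the explicit formula
(Literature.NumberTheory.LFunctions.explicit_formula, symmetric limit) is a limit of non-negative
reals; hence Re W(g⋆g̃) ≥ 0. Uses Literature API facts weilMellin_weilConv, weilMellin_weilReflect,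
explicit_formula. Provable now; calibrates that X is not stronger than RH. -/
@[route_item "route-RiemannHypothesis-WeilPos"]
def WeilposConverse : Prop :=
  Summit.RiemannHypothesis → ∀ a : ℝ, 0 < a → Literature.NumberTheory.LFunctions.WeilPositivityOn a

/-- `WeilposConverse` holds: proved by `Summit.RiemannHypothesis.RiemannHypothesis.Theorems.MotivicDoor.Rungs.rung_of_riemannHypothesis` @ 63e3dbb63739. -/
theorem WeilposConverse_holds : WeilposConverse := _root_.Summit.RiemannHypothesis.RiemannHypothesis.Theorems.MotivicDoor.Rungs.rung_of_riemannHypothesis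

/-- item stmt-RiemannHypothesis-18226 · support · rank 6 · open · by planner
why it might fail: The completion-cost bound is heuristic: at T = 3 the predicted margin (1+T)/π − 1 ≈ 0.27 may be eaten by stationary-phase errors O((kX)^(−1/2)) at X = e^3 ≈ 20 and by near-node window terms; one window can still host a short coherent chirp packet fed by a large value of ζ.
sources: Cruxes/SignConeOscillatory/Ideas/lattice-chirp-completion.md (crux idea r1), Titchmarsh1986, CarneiroMilinovichSoundararajan2019, arXiv:2003.10771, BondarenkoRadchenkoSeip2020, Bombieri2000Weil
[support] (re-homed from the superseded route SignCone, item stmt-RiemannHypothesis-18012; the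
judge's 'per-gap uncertainty inequality closing a nontrivial oscillatory sub-class') the unit-slack
PRIME-FREE sign-cone inequality Re W_ar(F) ≥ −Re F(0) for the SINGLE-HIGH-WINDOW (incoherent)
oscillatory class: node-nonnegative F ∈ P(a) (finite sums of autocorrelations g_i ⋆ g̃_i, supp g_i ⊆
[−a, a], Re F(log n) ≥ 0 for all n ≥ 2) whose far-field negativity {|t| ≥ log 2 : Re F(t) < 0} is
non-empty and lies in ONE window T ≤ |t| ≤ T + log 2 with T ≥ 3 (x = e^T ≥ 20: inside, the nodes log
n are an e^{−T}-dense image of the integer lattice [X, 2X]). Implied by X♭/X in-tree (X ⇒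
SignConeInequality ⇒ this; the class is non-empty for a > 3/2, p150937); UNCONDITIONAL target, the
one test of the uncertainty × node-lattice lever: (1) Poisson summation of the node functional
window by window (WindowedAliasingIdentity, Cruxes/SignConeOscillatory/SketchIdeator1.lean rc 0),
(2) stationary phase for the windowed chirps (Literature stationaryPhase, vanDerCorput_lemma47 —
proved), (3) the load-bearing completion-cost inequality. Registered skeleton d4a9010c3867 and idea
card Cruxes/SignConeOscillatory/ -/
@[route_item "route-RiemannHypothesis-WeilPos"]
def OscSingleWindow : Prop :=
  ∀ a : ℝ, 0 < a → ∀ (k : ℕ) (g : Fin k → ℝ → ℂ), (∀ i, (ContDiff ℝ ((⊤ : ℕ∞) : WithTop ℕ∞) (g i) ∧ HasCompactSupport (g i)) ∧ tsupport (g i) ⊆ Set.Icc (-a) a) → let F : ℝ → ℂ := fun t => ∑ i, MeasureTheory.convolution (g i) (fun u => (starRingEnd ℂ) ((g i) (-u))) (ContinuousLinearMap.mul ℂ ℂ) MeasureTheory.MeasureSpace.volume t; (∀ n : ℕ, 2 ≤ n → 0 ≤ (F (Real.log n)).re) → (∃ T : ℝ, 3 ≤ T ∧ ∀ t : ℝ,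 Real.log 2 ≤ |t| → (F t).re < 0 → T ≤ |t| ∧ |t| ≤ T + Real.log 2) → (∃ t : ℝ, Real.log 2 ≤ |t| ∧ (F t).re < 0) → let M : ℂ → ℂ := fun s => ∫ u : ℝ, F u * Complex.exp ((s - 1 / 2) * u); -(F 0).re ≤ (M 0 + M 1 + ((1 / (2 * Real.pi) : ℂ) * (∫ t : ℝ, M (1 / 2 + t * Complex.I) * ((Complex.digamma (1 / 4 + t / 2 * Complex.I)).re : ℂ)) - F 0 * (Real.log Real.pi : ℂ))).re

/-- item stmt-RiemannHypothesis-18200 · support · rank 9 · closed · proved by Summit.RiemannHypothesis.RiemannHypothesis.Theorems.WeilPos.slackRungLog2OfSlackThesis_proof (prover) · by planner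
[support] consequence edge / kill path: the thesis X♭ at cutoff log 2 IS the first slack rung, so a
certified refutation of #3 WeilposSlackRungLog2 kills X♭ (and RH). Provable now, one line: `fun h g
hg hs => h _ (Real.log_pos one_lt_two) g hg hs` (checked rc 0 in the judge-repair folder,
Sketch3.lean). [difficulty: provable-now] -/
@[route_item "route-RiemannHypothesis-WeilPos"]
def SlackRungLog2OfSlackThesis : Prop :=
  WeilposSlackThesis → WeilposSlackRungLog2

-- `SlackRungLog2OfSlackThesis` holds: proved by `Summit.RiemannHypothesis.RiemannHypothesis.Theorems.WeilPos.slackRungLog2OfSlackThesis_proof` (its module imports this route file, so no `_holds` link can be stated here).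

/-- item stmt-RiemannHypothesis-18227 · support · rank 9 · open · by planner
[support] consequence edge / kill path: X♭ implies the single-high-window sign-cone inequality #2
(in-tree: X♭ ⇒ RH by `closes`; RH ⇒ SignConeInequality by
`Theorems.SignCone.signConeInequality_iff_riemannHypothesis.2` (import
Theorems.SignConeSignConeInequalityCriterion); SignConeInequality ⇒ OscSingleWindow by dropping the
two window hypotheses), so a certified node-nonnegative single-window F with Re W_ar(F) < −Re F(0)
kills OscSingleWindow, X♭ and RH at once (kill criterion ii). Provable now in six lines (checked rc
0 in the judge-repair folder, Sketch3.lean: `intro h; have hX :=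
(signConeInequality_iff_riemannHypothesis).2 (closes h); intro a ha k g hg F hF hwin hneg M; exact
hX a ha k g hg hF`). [difficulty: provable-now] -/
@[route_item "route-RiemannHypothesis-WeilPos"]
def OscSingleWindowOfSlackThesis : Prop :=
  WeilposSlackThesis → OscSingleWindow

/-- item stmt-RiemannHypothesis-0099 · assembly · rank 1 · closed · proved by Summit.RiemannHypothesis.RiemannHypothesis.Theorems.weilCombAssembly_proof @ 3105e4d941a0 (prover) · by planner
Weil's criterion, direction positivity ⇒ RH [Weil1952; Bombieri2000 Thm 1; IwaniecKowalski2004 §5].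
Expected to be discharged with the named fact weil_criterion (cite request filed) as hypothesis: (h
: weil_criterion) → this. Proof idea in print: if ρ₀ off the line, build g with ĝ concentrated at ρ₀
and 1-ρ̄₀ making the zero side of the explicit formula for g⋆g̃ negative. -/
@[route_item "route-RiemannHypothesis-WeilPos"]
def Assembly : Prop :=
  (∀ a : ℝ, 0 < a → Literature.NumberTheory.LFunctions.WeilPositivityOn a) → Summit.RiemannHypothesis

/-- `Assembly` holds: proved by `Summit.RiemannHypothesis.RiemannHypothesis.Theorems.weilCombAssembly_proof` @ 3105e4d941a0. -/
theorem Assembly_holds : Assembly := _root_.Summit.RiemannHypothesis.RiemannHypothesis.Theorems.weilCombAssembly_proof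

/-! D-0027 §2.1 — DECIDING THEOREM (planner-authored via `route open/edit --closes-file`; by planner-rrepair-RiemannHypothesis-WeilPos-judg-84616b26-0 2026-08-17T14:37:18Z):
its hypotheses are this route's items and its conclusion the sub-problem Statement (glue_lint), and it elaborates with this file. -/

@[closes "route-RiemannHypothesis-WeilPos"] theorem closes (hR : WeilposSlackRungLog2) (hRes : SlackResidualLog2) : _root_.Summit.RiemannHypothesis :=
  have hS : WeilposSlackThesis := (show WeilposSlackRungLog2 → WeilposSlackThesis from hRes) hR
  _root_.Summit.RiemannHypothesis.RiemannHypothesis.Theorems.ConeMagnification_proof fun a ha =>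
    ⟨⇑ArithmeticFunction.vonMangoldt, fun _ => ArithmeticFunction.vonMangoldt_nonneg,
      ArithmeticFunction.vonMangoldt_apply_one, fun g hg hsupp => by
        have h := hS a ha g hg hsupp
        dsimp only
        refine h.trans_eq ?_
        unfold Literature.NumberTheory.LFunctions.weilQuadratic
          Literature.NumberTheory.LFunctions.weilFunctional
          Literature.NumberTheory.LFunctions.weilPolarTerm
          Literature.NumberTheory.LFunctions.weilPrimeTerm
          Literature.NumberTheory.LFunctions.weilArchTerm
          Literature.NumberTheory.LFunctions.weilArchIntegral
          Literature.NumberTheory.LFunctions.weilMellin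
          Literature.NumberTheory.LFunctions.weilConv
          Literature.NumberTheory.LFunctions.weilReflect
        congr 1
        ring⟩

end Summit.RiemannHypothesis.RiemannHypothesis.Theses.WeilPos
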